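import Summits.QuantumFields.BalabanUV.T4Continuum.Support.B13KPStepTermModel
import Literature.MeasureTheory.Lebesgue.VitaliSet

/-!
# NE5 ∕ U3 — A CERTIFIED OBJECTION (route P2, self-audit): for term data read through the records, route P2's one-run shape
# `TermDatum.Geometry` is UNSATISFIABLE whenever the core has a history label and its measure space carries a set that is not
# null-measurable (every core on `(ℝ, volume)`, or with `volume ≪ ν`, e.g. a Gaussian) — the binder `hgeo` displayed by the
# term-format END faces is VACUOUS for such cores; diagnosis and repair menu

Cell `pub-balaban`, unit `b2b-balaban-t4-ne5-p2` (T⁴ fan-out NE5 ∕ node U3, PROVER seat P2, lineage gen 19; GAPS `G-ne5p2-5`).  Summits-side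
evidence module under the LEAN PLACEMENT RULE (our own negative result about our own displayed binder; nothing of the manuscripts is asserted).
HONEST FRAMING: rung (B)+1 of the FINITE-VOLUME T⁴ programme — NOT infinite volume, NOT mass gap, NOT Clay, NOT NE5; this file does NOT refute
NE5 or any leaf: it shows that ONE displayed binder of the term-format END faces cannot be met by realistic cores, and says what must change.

DIAGNOSIS.  K6 (`ActivityTermDatum`, this lineage g15) types the one-run geometric∕measurability bookkeeping of a (2.14)-term as
`TermDatum.Geometry`, whose field `hopm : ∀ o : Op, AEStronglyMeasurable (fun x => opForm o x) ν` quantifies over EVERY operator input `o`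
(needed by `norm_term_sub_le`, which assumes nothing at the displaced point).  Row O1-b (leaf-07) types the operator slot as `Op := OpDatum (Species T
κ ι Ω 𝒴) = ℓ^∞(Species)` and indexes the potential species `potQ x Y b b'` ∕ `potR x Y` by the FIELD ARGUMENT `x : Ω` = the term's integration
point; leaf-08's `TermCore.toTermDatum` reads `kR o x Y := entry F o (.potR x Y)`.  Hence `x ↦ opForm o x` contains `τ Y₀ · wt · o(.potR x Y₀)`
with `o(.potR · Y₀)` an ARBITRARY bounded function of `x`: taking it to be the indicator of a set `A` shows
* §1 `nullMeasurableSet_of_geometry`: `(𝔠.toTermDatum F G ϱ).Geometry 𝔡` with some `Y₀ ∈ 𝔠.D` forces EVERY `A ⊆ Ω` to be `𝔠.ν`-null-measurable;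
* §2 `not_geometry_of_not_nullMeasurableSet`, and — by the tree's Vitali set `Literature.MeasureTheory.Lebesgue.Vitali.exists_not_nullMeasurableSet_real`
  ∕ `…_euclideanSpace` — **`not_geometry_real`** ∕ **`not_geometry_euclideanSpace`**: for cores over `Ω = ℝ` or `Ω = EuclideanSpace ℝ n` whose measure
  dominates Lebesgue measure (`volume ≪ 𝔠.ν`: Lebesgue itself, Gaussians, any measure with a positive density) and `𝔠.D ≠ ∅`, `¬ Geometry`;
* §3 `not_wellFormed_of_core`: consequently the binder `hwf`∕`hgeo` of this lineage's term-format END faces (`B13KPStepTermModel.ne5_above_max_kp_termModel`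
  & sequels) — and equally the section binder `hgeo : ∀ Z ℓ, (termData …).Geometry (𝔡 Z ℓ)` of leaf-08's `B13TermDataOpSecant` ∕ leaf-01's
  `B13StepOfRecordSecantTermwise` consumers — is UNSATISFIABLE as soon as ONE catalogued term of record has such a core and the window is
  nonempty.  The history side does NOT have this defect: `hhistm` is proved for every table by leaf-08's `histm_toTermDatum` because fork F2
  re-typed `Hist` as the MEASURABLE table space `B13HistM`.
WHAT IS NOT AFFECTED: every END face on generic `Slots` (`act` arbitrary); K6's theorems themselves (true, and non-vacuous for operator slots
whose read-outs are measurable in `x` for every `o`, e.g. finite `Ω`, or species not indexed by `x`); cores with `D = ∅`.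
REPAIR MENU (a ruling of record is requested from the row owner; nothing is re-wired here): (R-a, at the source, row O1-b) re-type the operator slot
for `x`-indexed species as the CLOSED SUBSPACE of `ℓ^∞(Species)` of data whose `x`-sections `x ↦ o(.potQ x Y b b')`, `x ↦ o(.potR x Y)` are
strongly measurable (a Banach subspace; `hopm` then PROVABLE from measurable `Xf`, `Bf` — the operator twin of fork F2); (R-b, downstream) keep
`OpDatum` but run route P2's END on the model RESTRICTED to that subspace (both runs' data of record lie in it iff the raw species are measurable in
`x` — a one-run side condition of printed KIND), `ReadLip`∕`RefAt`∕W1 transfer verbatim; (R-c, K6 side) weaken `Geometry.hopm` to the operator inputs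
actually used — incompatible with K2's `ActivityLipschitz₂` quantifying over all `q` unless combined with (R-b).  Until one of these lands, the
term-format END faces must be read with «`hgeo` satisfiable only for cores with `D = ∅` or discrete `Ω`».
0 sorry; axioms ⊆ {propext, Classical.choice, Quot.sound}.
-/

noncomputable section

open MeasureTheory
open scoped BigOperators

namespace Summit.QuantumFields.BalabanUV.T4Continuum.B13TermDataOpMeasurability

open Literature.MathematicalPhysics.QuantumFieldTheory.Balaban1983to89
open Literature.MathematicalPhysics.QuantumFieldTheory.Balaban1983to89.T4OutputRate (Carriers)
open Literature.MathematicalPhysics.QuantumFieldTheory.Balaban1983to89.T4ActivityTilt (diffForm sandwichKer mulKer)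
open Literature.MathematicalPhysics.QuantumFieldTheory.Balaban1983to89.T4ActivityTiltPotential (potSum quadPart)
open Summit.QuantumFields.BalabanUV.T4Continuum.ActivityTermModel (TermDatum TermConsts TermFamily)
open Summit.QuantumFields.BalabanUV.T4Continuum.B13Carriers (TwoRuns)
open Summit.QuantumFields.BalabanUV.T4Continuum.ClusterRepOfDomains (DomainGeometry)
open Summit.QuantumFields.BalabanUV.T4Continuum.B13DomainGeometryTR (domainGeometry)
open Summit.QuantumFields.BalabanUV.T4Continuum.B13InnerData (b13InnerData Bnd)
open Summit.QuantumFields.BalabanUV.T4Continuum.B13OpDatum (Format OpDatum entry assemble entry_assemble Species B13Weights InFormat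
  FormatBounded)
open Summit.QuantumFields.BalabanUV.T4Continuum.B13HistMeasurable (MeasPotFrame B13HistM)
open Summit.QuantumFields.BalabanUV.T4Continuum.B13StepTermLabels (InnerLabel innerLabels)
open Summit.QuantumFields.BalabanUV.T4Continuum.B13TermData (TermCore termData)
open Summit.QuantumFields.BalabanUV.T4Continuum.B13StepOfRecordTermData (TermSlots)
open Summit.QuantumFields.BalabanUV.T4Continuum.B13KPStepTermModel (termFamily)

/-! ## §1 One core: `Geometry` forces every subset of the integration space to be null-measurable -/

section Test

variable {T κ ι Ω 𝒴 : Type*} (F : Format (Species T κ ι Ω 𝒴))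

open Classical in
/-- [folklore] THE TEST KERNEL: the raw species vanishing everywhere except on the `𝐕″`-entries `potR x Y₀`, `x ∈ A`, where it equals
the format weight (so it is format-bounded with radius `1` and its normalised entry is the indicator of `A`). -/
def testKernel (Y₀ : 𝒴) (A : Set Ω) : Species T κ ι Ω 𝒴 → ℂ
  | .potR x Y => if Y = Y₀ ∧ x ∈ A then (F.wt (.potR x Y) : ℂ) else 0
  | _ => 0

/-- [folklore] The test kernel lies in the unit format ball. -/
theorem inFormat_testKernel (Y₀ : 𝒴) (A : Set Ω) : InFormat F (testKernel F Y₀ A) 1 := by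
  intro e
  cases e with
  | cov t a' a'' => simp [testKernel, (F.wt_pos _).le]
  | deltaKer t i j => simp [testKernel, (F.wt_pos _).le]
  | gammaConstituent t a' i => simp [testKernel, (F.wt_pos _).le]
  | potQ x Y b b' => simp [testKernel, (F.wt_pos _).le]
  | potR x Y =>
      simp only [testKernel]
      split_ifs
      · rw [F.norm_wt, one_mul]
      · simp [(F.wt_pos _).le]

/-- [folklore] THE TEST DATUM: the test kernel packaged as an operator datum (`assemble`). -/
def testDatum (Y₀ : 𝒴) (A : Set Ω) : OpDatum (Species T κ ι Ω 𝒴) := assemble F (testKernel F Y₀ A)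

/-- [folklore] Its raw entries ARE the test kernel. -/
theorem entry_testDatum (Y₀ : 𝒴) (A : Set Ω) (e : Species T κ ι Ω 𝒴) :
    entry F (testDatum F Y₀ A) e = testKernel F Y₀ A e :=
  entry_assemble (inFormat_testKernel F Y₀ A).formatBounded e

/-- [folklore] The test datum reads `0` on every Gaussian and `Q`-species … -/
@[simp] theorem entry_testDatum_cov (Y₀ : 𝒴) (A : Set Ω) (t : T) (a' a'' : κ) :
    entry F (testDatum F Y₀ A) (.cov t a' a'') = 0 := by rw [entry_testDatum]; rfl
/-- [folklore] -/
@[simp] theorem entry_testDatum_deltaKer (Y₀ : 𝒴) (A : Set Ω) (t : T) (i j : ι) :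
    entry F (testDatum F Y₀ A) (.deltaKer t i j) = 0 := by rw [entry_testDatum]; rfl
/-- [folklore] -/
@[simp] theorem entry_testDatum_gammaConstituent (Y₀ : 𝒴) (A : Set Ω) (t : T) (a' : κ) (i : ι) :
    entry F (testDatum F Y₀ A) (.gammaConstituent t a' i) = 0 := by rw [entry_testDatum]; rfl
/-- [folklore] -/
@[simp] theorem entry_testDatum_potQ (Y₀ : 𝒴) (A : Set Ω) (x : Ω) (Y : 𝒴) (b b' : κ) :
    entry F (testDatum F Y₀ A) (.potQ x Y b b') = 0 := by rw [entry_testDatum]; rfl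

open Classical in
/-- [folklore] … and the indicator of `A` (times the weight) on the `𝐕″`-species of the label `Y₀`. -/
theorem entry_testDatum_potR (Y₀ : 𝒴) (A : Set Ω) (x : Ω) (Y : 𝒴) :
    entry F (testDatum F Y₀ A) (.potR x Y) = if Y = Y₀ ∧ x ∈ A then (F.wt (.potR x Y) : ℂ) else 0 := by
  rw [entry_testDatum]; rfl

end Test

section OneCore

variable {C : Carriers} {P : MeasPotFrame C} {𝒴 : Type*} {dom : 𝒴 → C.Dom} {T κ ι Ω Ω₀ 𝒞 S : Type*} [MeasurableSpace Ω]
  [MeasurableSpace Ω₀] [Fintype ι] [Fintype κ] [DecidableEq ι] [DecidableEq κ]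
  (𝔠 : TermCore P dom T κ ι Ω Ω₀ 𝒞) (F : Format (Species T κ ι Ω 𝒴)) (G : B13Weights κ ι S 𝒴) (ϱ : ℝ)

open Classical in
/-- [folklore] **THE OPERATOR EXPONENT OF THE TERM DATUM OF RECORD AT THE TEST DATUM** is `τ Y₀ · wt(potR x Y₀) · 𝟙_A(x)` — every Gaussian
kernel and every `Q`-kernel reads `0`, the `𝐕″`-read-out reads the indicator (for `Y₀ ∈ D`). -/
theorem opForm_testDatum {Y₀ : 𝒴} (hY₀ : Y₀ ∈ 𝔠.D) (A : Set Ω) (x : Ω) :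
    (𝔠.toTermDatum F G ϱ).opForm (testDatum F Y₀ A) x =
      if x ∈ A then (G.τ Y₀ : ℂ) * (F.wt (.potR x Y₀) : ℂ) else 0 := by
  have hΓ : ∀ a b, (𝔠.toTermDatum F G ϱ).Γ (testDatum F Y₀ A) a b = 0 := fun a b => by
    simp only [TermDatum.Γ, mulKer, TermCore.toTermDatum_kL, entry_testDatum_gammaConstituent, zero_mul,
      Finset.sum_const_zero]
  have hdiff : diffForm ((𝔠.toTermDatum F G ϱ).R₁ (testDatum F Y₀ A)) ((𝔠.toTermDatum F G ϱ).kP (testDatum F Y₀ A))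
      ((𝔠.toTermDatum F G ϱ).Γ (testDatum F Y₀ A)) ((𝔠.toTermDatum F G ϱ).Xf x) ((𝔠.toTermDatum F G ϱ).Bf x) = 0 := by
    simp only [diffForm, TermDatum.R₁, sandwichKer, hΓ, TermCore.toTermDatum_kP, entry_testDatum_cov, zero_mul, mul_zero,
      Finset.sum_const_zero, add_zero]
  have hpot : potSum (𝔠.toTermDatum F G ϱ).D (𝔠.toTermDatum F G ϱ).bonds (𝔠.toTermDatum F G ϱ).τ
      ((𝔠.toTermDatum F G ϱ).kQ (testDatum F Y₀ A) x) ((𝔠.toTermDatum F G ϱ).kR (testDatum F Y₀ A) x) ((𝔠.toTermDatum F G ϱ).Bf x) =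
      if x ∈ A then (G.τ Y₀ : ℂ) * (F.wt (.potR x Y₀) : ℂ) else 0 := by
    simp only [potSum, quadPart, TermCore.toTermDatum_kQ, TermCore.toTermDatum_kR, entry_testDatum_potQ, entry_testDatum_potR,
      TermCore.toTermDatum_D, TermCore.toTermDatum_τ, mul_zero, zero_mul, Finset.sum_const_zero, zero_add]
    rw [Finset.sum_eq_single Y₀]
    · by_cases hx : x ∈ A <;> simp [hx]
    · intro Y _ hY
      simp [hY]
    · intro h
      exact absurd hY₀ h
  unfold TermDatum.opForm
  rw [hdiff, hpot, zero_add]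

variable [DecidableEq 𝒞]

/-- [folklore] **`Geometry` FORCES EVERY SUBSET OF THE INTEGRATION SPACE TO BE NULL-MEASURABLE** (for a core with a history label): apply
the field `hopm` to the test datum of `A`; the operator exponent is a nonvanishing multiple of `𝟙_A`, so its non-zero set — `A` itself — is
the preimage of a measurable set under an a.e.-measurable map. -/
theorem nullMeasurableSet_of_geometry {𝔡 : TermConsts} (hgeo : (𝔠.toTermDatum F G ϱ).Geometry 𝔡) {Y₀ : 𝒴} (hY₀ : Y₀ ∈ 𝔠.D)
    (A : Set Ω) : NullMeasurableSet A 𝔠.ν := by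
  have hm := (hgeo.hopm (testDatum F Y₀ A)).aemeasurable
  have hpre : (fun x => (𝔠.toTermDatum F G ϱ).opForm (testDatum F Y₀ A) x) ⁻¹' ({0}ᶜ : Set ℂ) = A := by
    ext x
    simp only [Set.mem_preimage, Set.mem_compl_iff, Set.mem_singleton_iff, opForm_testDatum 𝔠 F G ϱ hY₀]
    by_cases hx : x ∈ A
    · simp only [hx, if_true, iff_true]
      exact mul_ne_zero (by exact_mod_cast G.τ_ne Y₀) (by exact_mod_cast F.wt_ne_zero _)
    · simp [hx]
  have h := hm.nullMeasurable (MeasurableSet.singleton (0 : ℂ)).compl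
  rw [hpre] at h
  exact h

/-! ## §2 Hence `Geometry` is FALSE for cores with a history label over a measure space carrying a non-null-measurable set -/

/-- [folklore] If some subset of `Ω` is not `ν`-null-measurable and the core has a history label, the term datum of record has NO `Geometry`. -/
theorem not_geometry_of_not_nullMeasurableSet {A : Set Ω} (hA : ¬ NullMeasurableSet A 𝔠.ν) {Y₀ : 𝒴} (hY₀ : Y₀ ∈ 𝔠.D) (𝔡 : TermConsts) :
    ¬ (𝔠.toTermDatum F G ϱ).Geometry 𝔡 := fun hgeo =>
  hA (nullMeasurableSet_of_geometry 𝔠 F G ϱ hgeo hY₀ A)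

end OneCore

/-- [folklore] **NO `Geometry` FOR CORES OVER `(ℝ, ν)` WITH `volume ≪ ν`** (Lebesgue measure itself, any Gaussian, any measure with a positive
density) and a history label — by the tree's Vitali set (`Literature.MeasureTheory.Lebesgue.Vitali.exists_not_nullMeasurableSet_real`). -/
theorem not_geometry_real {C : Carriers} {P : MeasPotFrame C} {𝒴 : Type*} {dom : 𝒴 → C.Dom} {T κ ι Ω₀ 𝒞 S : Type*} [MeasurableSpace Ω₀]
    [Fintype ι] [Fintype κ] [DecidableEq ι] [DecidableEq κ] [DecidableEq 𝒞] (𝔠 : TermCore P dom T κ ι ℝ Ω₀ 𝒞)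
    (F : Format (Species T κ ι ℝ 𝒴)) (G : B13Weights κ ι S 𝒴) (ϱ : ℝ) (hν : (volume : Measure ℝ) ≪ 𝔠.ν) {Y₀ : 𝒴} (hY₀ : Y₀ ∈ 𝔠.D)
    (𝔡 : TermConsts) : ¬ (𝔠.toTermDatum F G ϱ).Geometry 𝔡 := by
  obtain ⟨A, hA, -⟩ := Literature.MeasureTheory.Lebesgue.Vitali.exists_not_nullMeasurableSet_real
  exact not_geometry_of_not_nullMeasurableSet 𝔠 F G ϱ (fun h => hA (h.mono_ac hν)) hY₀ 𝔡

/-- [folklore] **NO `Geometry` FOR CORES OVER `(EuclideanSpace ℝ n, ν)` WITH `volume ≪ ν`**, `n` nonempty (the Gaussian variables of (2.14)), and a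
history label (`…exists_not_nullMeasurableSet_euclideanSpace`). -/
theorem not_geometry_euclideanSpace {C : Carriers} {P : MeasPotFrame C} {𝒴 : Type*} {dom : 𝒴 → C.Dom} {T κ ι Ω₀ 𝒞 S n : Type*}
    [MeasurableSpace Ω₀] [Fintype ι] [Fintype κ] [DecidableEq ι] [DecidableEq κ] [DecidableEq 𝒞] [Fintype n] [DecidableEq n] (i : n)
    (𝔠 : TermCore P dom T κ ι (EuclideanSpace ℝ n) Ω₀ 𝒞) (F : Format (Species T κ ι (EuclideanSpace ℝ n) 𝒴)) (G : B13Weights κ ι S 𝒴) (ϱ : ℝ)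
    (hν : (volume : Measure (EuclideanSpace ℝ n)) ≪ 𝔠.ν) {Y₀ : 𝒴} (hY₀ : Y₀ ∈ 𝔠.D) (𝔡 : TermConsts) :
    ¬ (𝔠.toTermDatum F G ϱ).Geometry 𝔡 := by
  obtain ⟨A, hA, -⟩ := Literature.MeasureTheory.Lebesgue.Vitali.exists_not_nullMeasurableSet_euclideanSpace (ι := n) i
  exact not_geometry_of_not_nullMeasurableSet 𝔠 F G ϱ (fun h => hA (h.mono_ac hν)) hY₀ 𝔡

/-! ## §3 Consequence for the term-format END faces: the well-formedness binder is unsatisfiable for such cores -/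

section Record

variable {𝔾 : Type} [GaugeGroup 𝔾] {R : TwoRuns 𝔾} {P : MeasPotFrame R.carriers} {𝒴 : Type*} {dom : 𝒴 → R.carriers.Dom}
  {T κ ι S Ω Ω₀ 𝒞 IOp : Type*} [MeasurableSpace Ω] [MeasurableSpace Ω₀] [Fintype ι] [Fintype κ] [DecidableEq ι] [DecidableEq κ]
  [DecidableEq 𝒞] (𝔖 : TermSlots R P dom T κ ι S Ω Ω₀ 𝒞 IOp) (E₀ cB : ℝ)
  (𝔡 : R.carriers.Dom → InnerLabel R.carriers.Dom (Bnd R) → TermConsts)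

/-- [folklore] **THE BINDER `hwf` OF THIS LINEAGE's TERM-FORMAT END FACES IS UNSATISFIABLE** as soon as ONE catalogued term of record `(Z, ℓ)`
(`Z ∈ 𝐃_k`, `ℓ ∈ innerLabels k Z`) has a core with a history label over a measure space with a non-null-measurable set, and the window is
nonempty: then `¬ (termFamily 𝔖 E₀ cB 𝔡).WellFormed W`.  (Same for leaf-08's unrestricted section binder `∀ Z ℓ, (termData …).Geometry (𝔡 Z ℓ)`,
a fortiori.) -/
theorem not_wellFormed_of_core {W : Set (ℕ → ℝ)} (hW : W.Nonempty) [Nonempty R.carriers.BgB] {k : ℕ} {Z : R.carriers.Dom}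
    (hZ : Z ∈ (domainGeometry R).level k) {ℓ : InnerLabel R.carriers.Dom (Bnd R)} (hℓ : ℓ ∈ innerLabels (b13InnerData R) k Z)
    {A : Set Ω} (hA : ¬ NullMeasurableSet A (𝔖.core Z ℓ).ν) {Y₀ : 𝒴} (hY₀ : Y₀ ∈ (𝔖.core Z ℓ).D) :
    ¬ (termFamily 𝔖 E₀ cB 𝔡).WellFormed W := by
  intro hwf
  obtain ⟨g, hg⟩ := hW
  have hsc : R.carriers.scale Z = k := ((domainGeometry R).mem_level Z _).1 hZ
  have hZ' : Z ∈ (domainGeometry R).level (R.carriers.scale Z) := (domainGeometry R).self_mem_level Z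
  have hℓ' : ℓ ∈ innerLabels (b13InnerData R) (R.carriers.scale Z) Z := by rw [hsc]; exact hℓ
  have hgeo := hwf.hgeo g hg (Classical.arbitrary R.carriers.BgB) Z Z hZ' ℓ hℓ'
  exact not_geometry_of_not_nullMeasurableSet (𝔖.core Z ℓ) (𝔖.F (R.carriers.scale Z)) (𝔖.G (R.carriers.scale Z))
    (𝔖.rHist (R.carriers.scale Z)) hA hY₀ (𝔡 Z ℓ) hgeo

end Record

end Summit.QuantumFields.BalabanUV.T4Continuum.B13TermDataOpMeasurability

end
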